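import Summits.CriticalPhenomena.CardyFormulaZ2.Theses.CardyWhiteToColoured
import Summits.CriticalPhenomena.CardyFormulaZ2.Theorems.CardyWhiteToColouredNoiseFlowFromParts

/-!
# `Assembly` for route CardyWhiteToColoured (item stmt-CriticalPhenomena-4602)

Pure bookkeeping.  `Assembly` is
`DriftBound → NoiseDiscretisation → ModelExists → EuclideanCovariance → LimitPayoff →
SimilarityUpgrade → CardyRigidity → CardyFormulaZ2`, and it is assembled as follows.

* `DriftBound` and `NoiseDiscretisation` give `NoiseFlowComparison` by the already landed glue
  `Summit.CriticalPhenomena.CardyFormulaZ2.Theorems.noiseFlowFromParts_proof`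
  (item stmt-CriticalPhenomena-14140, triangle inequality in the `lim_(ℓ→0) limsup_(δ→0⁺)` form).
* `LimitPayoff` applied to `NoiseFlowComparison`, `EuclideanCovariance`, `ModelExists` yields
  similarity-invariant full limits `Φ`, which is literally the hypothesis of `SimilarityUpgrade`;
  the latter returns `f : ℝ → ℝ` with `R.HasCrossingLimit (bondDomainCrossingProb R) f` for every
  conformal rectangle `R`.
* `CardyRigidity f` gives `Set.EqOn f cardyFunction (Set.Ioo 0 1)`; since every uniformizing datum
  `(φ, x)` of `R` has `crossRatio x ∈ (0, 1)`
  (`ConformalRectangle.crossRatio_mem_Ioo_of_isUniformizing`), rewriting `f (crossRatio x)` into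
  `cardyFunction (crossRatio x)` in the limit statement proves `CardyFormulaZ2`.
-/

namespace Summit.CriticalPhenomena.CardyFormulaZ2.Theorems.CardyWhiteToColoured

open Filter Set Topology
open Summit.CriticalPhenomena.CardyFormulaZ2.Theses.CardyWhiteToColoured

/-- **`Assembly`** (item stmt-CriticalPhenomena-4602 of route CardyWhiteToColoured):
`DriftBound → NoiseDiscretisation → ModelExists → EuclideanCovariance → LimitPayoff →
SimilarityUpgrade → CardyRigidity → CardyFormulaZ2`.  The two layer-1 comparisons give
`NoiseFlowComparison` (`noiseFlowFromParts_proof`); `LimitPayoff` turns it (with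
`EuclideanCovariance`, `ModelExists`) into similarity-invariant full crossing limits;
`SimilarityUpgrade` makes them a function `f` of the conformal modulus; `CardyRigidity` identifies
`f` with `cardyFunction` on `(0, 1)`, where every cross-ratio of a uniformizing datum lives. -/
theorem assembly_proof :
    Summit.CriticalPhenomena.CardyFormulaZ2.Theses.CardyWhiteToColoured.Assembly := by
  intro hD hN hM hE hP hS hR
  show Literature.Probability.Percolation.CardyFormulaZ2
  intro R φ x hφx
  obtain ⟨f, hf⟩ :=
    hS (hP (Summit.CriticalPhenomena.CardyFormulaZ2.Theorems.noiseFlowFromParts_proof hD hN) hE hM)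
  have hfx : f (Literature.Probability.RandomPlanarGeometry.crossRatio x) =
      Literature.Probability.RandomPlanarGeometry.cardyFunction
        (Literature.Probability.RandomPlanarGeometry.crossRatio x) :=
    hR f hf
      (Literature.Probability.RandomPlanarGeometry.ConformalRectangle.crossRatio_mem_Ioo_of_isUniformizing
        hφx)
  rw [← hfx]
  exact hf R φ x hφx

end Summit.CriticalPhenomena.CardyFormulaZ2.Theorems.CardyWhiteToColoured
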